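import Summits.ABC.ABC.Theses.DefiniteXi
import Summits.ABC.ABC.Theorems.DefiniteXiFreyModularityIsModular
import Summits.ABC.ABC.Theorems.DefiniteXiFreyModularityStubAbsIrrSqrtFive
import Summits.ABC.ABC.Theorems.DefiniteXiFreyModularityStubNineTransfer
import Summits.ABC.ABC.Theorems.DefiniteXiFreyModularityStubDegreeNeTwenty
import Summits.ABC.ABC.Theorems.DefiniteXiFreyModularityStubFreySemistableDichotomy
import Summits.ABC.ABC.Theorems.DefiniteXiFreyModularityStubFreySwanOdd
import Summits.ABC.ABC.Theorems.DefiniteXiFreyModularityStubSwanEvenOfStableLine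
import Summits.ABC.ABC.Theorems.DefiniteXiFreyModularityStubFreyFiveIrreducibleGlue
import Summits.ABC.ABC.Theorems.DefiniteXiFreyModularityStubSwanOddNonabelian
import Summits.ABC.ABC.Theorems.DefiniteXiFreyModularityStubFreyCaseBSixteen
import Summits.ABC.ABC.Theorems.DefiniteXiFreyModularityStubCorner
import Summits.ABC.ABC.Theorems.DefiniteXiFreyModularityStubFreyCaseBThreeReducible
import Summits.ABC.ABC.Theorems.DefiniteXiFreyModularityStubFreyCaseBWitness
import Summits.ABC.ABC.Theorems.DefiniteXiFreyModularityStubFreyCaseBAllPairs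
import Literature.NumberTheory.Automorphic.CDTTheorem712ConductorStepProofs
import Literature.NumberTheory.Automorphic.CDTTheorem712TwoLiftsProofs
import Literature.NumberTheory.Automorphic.CDTTheorem722TwoFactsProofs
import Literature.NumberTheory.EllipticCurves.SzpiroFreyCurveProofs
import Literature.NumberTheory.EllipticCurves.SwanConductorTorsionProofs
import Literature.NumberTheory.EllipticCurves.KubertTwoTenProofs
import Literature.NumberTheory.EllipticCurves.SemistableModPImageReducibleProofs
import Literature.NumberTheory.EllipticCurves.HasseWeilAbelianConductorSwanIndependenceTwoProofs
import Literature.NumberTheory.DiophantineGeometry.GeneralizedFermatTwoPowerCoefficientFreySwanEightProofs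
import Literature.NumberTheory.DiophantineGeometry.FreyCurveConductorTwoTwistDichotomyProofs
import HarnessLib

/-!
# Crux `FreyModularity` (stmt-ABC-11340), line `Sketch`: the semistable Wiles–Diamond road for Frey curves

Skeleton of the line (lead prover; continuation lead `c1`, reshape 3 — ALL FOUR reshape-3 stubs LANDED: the only
`sorry`s left are the three modularity engines S1–S3; continuation lead `c2`, reshape 4 — the switch S3 is
re-registered in Wiles' printed FROM-A-CURVE form, verbatim the tree's named fact `BCDT.CDT_three_five_switch`,
which is all the composition consumes and is strictly weaker than the Shepherd-Barron–Taylor form).  The crux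
`Summit.ABC.ABC.Theses.DefiniteXi.FreyModularity` is, by the landed
`freyModularity_iff_forall_isModular_freyCurve` (p85939), exactly "every Frey curve
`E_(a,b) = freyCurve a b` (`a ⊥ b`, `ab(a+b) ≠ 0`) is `BCDT.IsModular`".  The line proves this along
the printed architecture of Conrad–Diamond–Taylor 1999, proof of Thm. 7.1.2 (p. 556) — whose glue is
a theorem of the tree (`CDT_theorem_7_1_2_of_CDT721_722_723_switch`) — with every deep input
WEAKENED to what the Frey family needs (Diamond–Kramer 1995; Rubin / Silverberg / Diamond in
Cornell–Silverman–Stevens 1997):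

* `stub_modThree` + `stub_liftThree` + `stub_threeImpTwo` — CDT Thm. 7.2.1 only for curves SEMISTABLE
  AT 3 (`9 ∤ N_E`), cut (reshape 5, lead `c2`) into the tree's catalogued atoms: Langlands–Tunnell for
  `ρ̄_{E,3}` (S1a), the Galois-theoretic lifting `ρ̄_{E,3}` modular ⇒ `ρ_{E,3}` modular for `9 ∤ N_E`
  (S1b: Wiles / Taylor–Wiles / Diamond 1996, no potentially Barsotti–Tate types), and BCDT's (3) ⇒ (2)
  (S9: Eichler–Shimura, Faltings, Carayol).  [XL named-fact debts, each seated in Literature]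
* `stub_liftFive` (+ `stub_threeImpTwo`) — CDT Thm. 7.2.2 only for curves SEMISTABLE AT 5 (`25 ∤ N_E`),
  likewise in Galois form (S2: Diamond 1996 Thm. 5.3 at `ℓ = 5`).  [XL named-fact debt]
* `stub_switch` — Wiles' `3`–`5` switch FROM A CURVE, verbatim the tree's named fact
  `BCDT.CDT_three_five_switch` (CDT 1999, proof of Thm. 7.1.2, p. 556; Wiles 1995 Ch. 5): for `E/ℚ` with
  `27 ∤ N_E`, no framed `ρ̄_{E,3}` absolutely irreducible over `ℚ(√-3)`, and `ρ̄_{E,5}|ℚ(√5)` absolutely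
  irreducible, some `E'/ℚ` has `E'[5] ≅ E[5]` and `ρ̄_{E',3}|ℚ(√-3)` absolutely irreducible.  (Reshape 4,
  lead `c2`: reshapes 1–3 carried the Shepherd-Barron–Taylor form
  `BCDT.exists_isTorsionGaloisRep_five_and_surjective_three` — every abstract `ρ̄` with cyclotomic
  determinant — which implies this one by the tree's proved
  `CDT_three_five_switch_of_exists_isTorsionGaloisRep_five_and_surjective_three`; the composition only
  ever switches `ρ̄_{E,5}` of the Frey curve itself, where `[E] ∈ X_E(5)(ℚ)` makes the twist of `X(5)`
  a `ℙ¹` for free.)  [L debt]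
* **Reshape 3 (lead `c1`): the `X₀(20)` stub `stub_degreeNeTwenty` of reshape 2 — Diophantine
  content the tree cannot reach (no modular curve `X₀(N)` with its moduli interpretation) — is
  REPLACED by the Diamond–Kramer / Serre / Kubert road to the same Frey rigidity "`ρ̄_{E,5}` is
  irreducible for every Frey curve", every leaf of which is a PROVED theorem of the tree:**
  after the Rubin–Silverberg normalisation `A ≡ −1 (mod 4)`, `2 ∣ B` (translations by `2`-torsion
  points and the quadratic twist by `−1`, which is `E_(b,a)` on the nose), Diamond–Kramer's `2`-adic
  table (Math. Res. Lett. 2 (1995), Lemma 2) splits the family: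
  - `16 ∣ B`: `E` is semistable at every prime, so by Serre 1972 §5.4 Prop. 21 ii) (tree:
    `WeierstrassCurve.smul_eq_or_smul_sub_mem_of_isSemistable`) a `Γ_ℚ`-stable line of `E[5]` is
    fixed pointwise or has trivial quotient character — `stub_freySemistableDichotomy`;
  - `2 ∥ B`, `4 ∥ B`, `8 ∥ B`: `E` is additive at `2` with `f₂ ∈ {5, 3, 3}`, i.e. the Swan conductor
    of `E[5]` at a prime above `2` is `3` or `1` — ODD — by the tree's Galois-side computations of
    `Sw(E[3])` (fake-point method, `ThreeTorsionSwanAtTwoClass…`) and the `ℓ`-independence of the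
    Swan conductor (`swanConductorAt_rationalTate_eq_swanConductorAt_rationalTate`) —
    `stub_freySwanOdd`; whereas a `Γ_ℚ`-stable line forces it to be EVEN (`Sw(E[5]) = 2·Sw(r)` for
    the isogeny character `r`, and `Sw(r) ∈ ℕ` by the integrality of Artin conductors / Hasse–Arf,
    both theorems of the tree) — `stub_swanEvenOfStableLine` (Diamond–Kramer Lemma 3);
  - and the glue `stub_freyFiveIrreducibleGlue` (lead): normalisation, twist invariance, the single
    `j = 1728` exception `E_(−1,2) ≅ (y² = x³ − x)` (where `c₆ = 0`; handled by `a₃ = 0`), and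
    KUBERT 1976 — `X₁(2,10)(ℚ)` = cusps, PROVED in the tree (`Kubert1976_no_two_ten_holds`): a
    curve over `ℚ` with full rational `2`-torsion carries no rational point of order `5`, which
    kills both branches of the semistable dichotomy (on `E`, resp. on the `5`-isogenous `E/C`).
* `stub_absIrrSqrtFive` — CLOSED (p102499).   * `stub_nineTransfer` — CLOSED (p110220).
* **Reshape 7 (lead `c52`)**: side stubs S14 (`stub_freyCaseBThreeReducible`: case B ⇒ `ρ̄_{E,3}`
  reducible with `ρ̄^{ss} = 1 ⊕ χ̄₃`, Serre's Prop. 21 — a theorem of the tree), S15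
  (`stub_freyCaseBMultiplicativeThree`: case B ⇒ `3 ∣ abc`, multiplicative at `3`) and S18
  (`stub_freyCaseBWitness`: case B is inhabited, `5 + 27 = 32`), S17
  (`stub_freyCaseBThreeReducibleAll`: case B ⇒ `E[3]` reducible for every Frey curve) — the exact shape of case B; the
  five atoms unchanged.  S14/S15 CLOSED (p163490), S18 CLOSED (p163711), S17 CLOSED (p165224).

`FreyModularity_of` composes them exactly as CDT p. 556 (see `isModular_freyCurve_of_stubs`).
-/

-- `Summit.<Summit>.<Problem>` is the mandated summit-side namespace (CONVENTIONS §2); for the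
-- single-conjunct summit `ABC` the two coincide, so the duplicate `ABC.ABC` is deliberate.
set_option linter.dupNamespace false

noncomputable section

open scoped MatrixGroups NumberField

open Literature.NumberTheory.EllipticCurves
open Literature.NumberTheory.EllipticCurves.ModularForms
open Literature.NumberTheory.Automorphic
open Literature.NumberTheory.Automorphic.BCDT
open Literature.NumberTheory.GaloisRepresentations
open WeierstrassCurve IsDedekindDomain

namespace Summit.ABC.ABC.Cruxes.FreyModularity.Sketch

-- `E[n]` as an `𝔽_n`-module (needed to speak of `W.torsionGaloisRep n`, as in the tree's Swan files).
attribute [local instance] AddSubgroup.torsionBy.zmodModule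

/-! ## The registered stubs -/

/-!
### Reshape 5 (lead `c2`): the two lifting engines cut into the tree's catalogued ATOMS

Reshapes 1–4 carried S1 = "CDT 7.2.1 restricted to `9 ∤ N`" (conclusion `BCDT.IsModular W`) and
S2 = "CDT 7.2.2 restricted to `25 ∤ N`".  Each is a COMPOSITE of printed theorems that the tree's
Literature already separates — and whose glue it PROVES (`CDT_theorem_7_2_1_of_modThree_of_lift_of_three_imp_two`,
`CDT_theorem_7_2_2_of_lift_of_three_imp_two`, `modThree_of_langlands_tunnell`,
`isModular_of_isModularGaloisRepTate_of_three_facts`): Langlands–Tunnell for `ρ̄_{E,3}` (S1a), the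
GALOIS-THEORETIC modularity lifting statements `ρ̄_{E,ℓ}` modular ⇒ `ρ_{E,ℓ}` modular at `ℓ = 3, 5` for
curves semistable at `ℓ` (S1b, S2: Wiles 1995 / Taylor–Wiles 1995 / Diamond 1996 — NOT CDT's potentially
Barsotti–Tate theorem 7.1.1, which the Frey family never needs), and BCDT's implication (3) ⇒ (2)
"`ρ_{E,ℓ}` modular ⇒ `E` modular" (S9: Eichler–Shimura, Faltings, Carayol).  Registering the atoms makes
the crux close stub by stub as the corresponding Literature leaves are discharged, each by a one-line
`--supports` file, and states the residual of Frey modularity in its weakest printed form: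
{Langlands–Tunnell, Diamond 1996 at `3` and at `5` (semistable at `ℓ`), (3) ⇒ (2), Wiles' switch}.
The old composite shapes are recovered below as PROVED glue (`liftThree_of_stubs`, `liftFive_of_stubs`),
so `isModular_freyCurve_of_stubs` is unchanged.
-/

/-- **Stub S1a — "`ρ̄_{E,3}` is modular by the theorem of Langlands and Tunnell"** (Wiles 1995, Ch. 5;
CDT 1999, proof of Thm. 7.2.1, first sentence; BCDT 2001 §2.2, p. 862): for an elliptic curve `E/ℚ`
and a framed model `ρ̄` of `E[3]` which is absolutely irreducible, `ρ̄` is modular in BCDT's sense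
(`ModPGaloisRep.IsModular`: `ρ̄ ∼ ρ̄_{g,λ}` for an eigenform `g`, here the weight-one Langlands–Tunnell
form lifted through `GL₂(𝔽₃) ↪ GL₂(ℤ[√-2])`).  Exactly the hypothesis shape `hmod3` of the tree's
`CDTTheorem712TwoLiftsProofs`; it is the tree's PROVED theorem `modThree_of_langlands_tunnell` granted
the catalogued named fact `langlands_tunnell` (for every `σ : Γ_ℚ → GL₂(ℂ)`), itself proved in the
tree from the seated leaves of `StrongArtinGL2` / `LanglandsTunnellTwist` (`langlands_tunnell_of_leaves'`).
[cite: Wiles1995Annals, Ch. 5] -/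
theorem stub_modThree :
    ∀ (W : WeierstrassCurve ℚ) [W.IsElliptic] (ρ : ModPGaloisRep ℚ (ZMod 3) 2),
      W.IsTorsionGaloisRep 3 ρ → FramedRep.IsAbsolutelyIrreducible ρ → ρ.IsModular := by
  sorry

/-- **Stub S1b — modularity lifting at `3` for curves semistable at `3`, Galois form** (Wiles 1995
Thm. 0.2 / Taylor–Wiles 1995; Diamond 1996 Thm. 5.4: arbitrary reduction at `p ≠ 3`): for an elliptic
curve `E/ℚ` with `9 ∤ N_E` (semistable at `3`, so `ρ_{E,3}|_{G₃}` is Barsotti–Tate or ordinary) and a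
framed model `ρ̄` of `E[3]` with `ρ̄|_{ℚ(√-3)}` absolutely irreducible and `ρ̄` modular, the `3`-adic
representation `ρ_{E,3}` on the Tate module is modular (`W.IsModularGaloisRepTate 3`: `ρ_{E,3} ∼ ρ_{f,λ}`
for an eigenform `f`).  This is the hypothesis shape `hlift`/`lift₃` of the tree's
`CDTTheorem712TwoLiftsProofs` (there with CDT's `27 ∤ N_E`) RESTRICTED to `9 ∤ N_E` — Diamond 1996, no
potentially Barsotti–Tate types; implied by `BCDT.CDT_theorem_7_2_1` (`lift_three_of_CDT_theorem_7_2_1`).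
[cite: Diamond1996, Thm. 5.4] -/
theorem stub_liftThree :
    ∀ (W : WeierstrassCurve ℚ) [W.IsElliptic] (ρ : ModPGaloisRep ℚ (ZMod 3) 2),
      W.IsTorsionGaloisRep 3 ρ → ρ.IsAbsIrreducibleOverSqrt (-3) → ¬ 9 ∣ W.conductorNorm ℤ →
      ρ.IsModular → W.IsModularGaloisRepTate 3 := by
  sorry

/-- **Stub S2 — modularity lifting at `5` for curves semistable at `5`, Galois form** (Diamond 1996
Thm. 5.3 at `ℓ = 5`; Rubin, in Cornell–Silverman–Stevens 1997, Thm. B): for an elliptic curve `E/ℚ`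
with `25 ∤ N_E` and a framed model `ρ̄` of `E[5]` with `ρ̄|_{ℚ(√5)}` absolutely irreducible and `ρ̄`
modular, `ρ_{E,5}` is modular (`W.IsModularGaloisRepTate 5`).  This is the hypothesis shape `hlift` of
the tree's `CDTTheorem722` RESTRICTED to `25 ∤ N_E` (semistable at `5`: no potentially supersingular
`e = 3` analysis, no CDT Thm. 7.1.1); implied by `BCDT.CDT_theorem_7_2_2` (`lift_of_CDT_theorem_7_2_2`).
[cite: Diamond1996, Thm. 5.3] -/
theorem stub_liftFive :
    ∀ (W : WeierstrassCurve ℚ) [W.IsElliptic] (ρ : ModPGaloisRep ℚ (ZMod 5) 2),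
      W.IsTorsionGaloisRep 5 ρ → ρ.IsAbsIrreducibleOverSqrt 5 → ¬ 25 ∣ W.conductorNorm ℤ →
      ρ.IsModular → W.IsModularGaloisRepTate 5 := by
  sorry

/-- **Stub S9 — BCDT's (3) ⇒ (2): "`ρ_{E,ℓ}` modular ⇒ `E` modular"** (Breuil–Conrad–Diamond–Taylor
2001, Introduction, p. 845: "The implication (3) ⇒ (2) follows from a theorem of Carayol [Ca1] and a
theorem of Faltings [Fa2]"): for an elliptic curve `E/ℚ` and a prime `ℓ`, if `ρ_{E,ℓ} ∼ ρ_{f,λ}` for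
some eigenform `f` (`W.IsModularGaloisRepTate ℓ`) then there is a newform of weight `2` on `Γ₀(N_E)`
with `aₙ(f) = aₙ(E)` (`BCDT.IsModular W`).  Exactly the hypothesis shape `h32` of the tree's
`CDTTheorem722` / `CDTTheorem712TwoLiftsProofs` (consumed here at `ℓ = 3` and `ℓ = 5` only); it is the
tree's PROVED `isModular_of_isModularGaloisRepTate_of_two_facts` granted the two catalogued facts
`eichlerShimuraConstruction` and `IsNewformOf.level_eq_conductorNorm` (Carayol) — Faltings' isogeny
theorem `WeierstrassCurve.isIsogenous_iff_frobeniusTrace_eq` being discharged in the tree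
(`isIsogenous_iff_frobeniusTrace_eq_holds`). [cite: BCDTJAMS2001, Introduction ((3) ⇒ (2))] -/
theorem stub_threeImpTwo :
    ∀ (W : WeierstrassCurve ℚ) [W.IsElliptic] [NeZero (W.conductorNorm ℤ)] (ℓ : ℕ) [Fact ℓ.Prime],
      W.IsModularGaloisRepTate ℓ → BCDT.IsModular W := by
  sorry

/-- **Stub S3 — Wiles' `3`–`5` switch from a curve** (Wiles 1995 Ch. 5, as printed by
Conrad–Diamond–Taylor 1999 in the proof of Thm. 7.1.2, p. 556: "Wiles' argument using the Hilbert
Irreducibility Theorem shows that there is an elliptic curve `E'` over `ℚ` such that `ρ̄_{E',5} ≅ ρ̄_{E,5}`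
and `ρ̄_{E',3}|_{ℚ(√-3)}` is absolutely irreducible"), with all the standing hypotheses of that point of
the proof kept: `27 ∤ N_E`, no framed model of `E[3]` absolutely irreducible over `ℚ(√-3)`, and the
framed model `ρ̄` of `E[5]` absolutely irreducible over `ℚ(√5)`.  VERBATIM the tree's named fact
`BCDT.CDT_three_five_switch` (`stub_switch_iff_CDT_three_five_switch` below is `Iff.rfl`); implied by
the Shepherd-Barron–Taylor form `BCDT.exists_isTorsionGaloisRep_five_and_surjective_three` of reshapes
1–3 (`stub_switch_of_exists_isTorsionGaloisRep_five_and_surjective_three`).  Reshape 4 (lead `c2`).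
[cite: ConradDiamondTaylor1999, proof of Thm. 7.1.2 (p. 556)] -/
theorem stub_switch :
    ∀ (W : WeierstrassCurve ℚ) [W.IsElliptic], ¬ 27 ∣ W.conductorNorm ℤ →
      (∀ ρ₃ : ModPGaloisRep ℚ (ZMod 3) 2, W.IsTorsionGaloisRep 3 ρ₃ →
        ¬ ρ₃.IsAbsIrreducibleOverSqrt (-3)) →
      ∀ (ρ : ModPGaloisRep ℚ (ZMod 5) 2), W.IsTorsionGaloisRep 5 ρ → ρ.IsAbsIrreducibleOverSqrt 5 →
      ∃ (W' : WeierstrassCurve ℚ) (_ : W'.IsElliptic), W'.IsTorsionGaloisRep 5 ρ ∧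
        ∃ ρ₃' : ModPGaloisRep ℚ (ZMod 3) 2, W'.IsTorsionGaloisRep 3 ρ₃' ∧
          ρ₃'.IsAbsIrreducibleOverSqrt (-3) := by
  sorry

/-- The registered signature of `stub_switch` is, definitionally, the tree's named fact
`BCDT.CDT_three_five_switch` (CDT 1999, proof of Thm. 7.1.2, p. 556). [folklore] -/
theorem stub_switch_iff_CDT_three_five_switch :
    (∀ (W : WeierstrassCurve ℚ) [W.IsElliptic], ¬ 27 ∣ W.conductorNorm ℤ →
      (∀ ρ₃ : ModPGaloisRep ℚ (ZMod 3) 2, W.IsTorsionGaloisRep 3 ρ₃ →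
        ¬ ρ₃.IsAbsIrreducibleOverSqrt (-3)) →
      ∀ (ρ : ModPGaloisRep ℚ (ZMod 5) 2), W.IsTorsionGaloisRep 5 ρ → ρ.IsAbsIrreducibleOverSqrt 5 →
      ∃ (W' : WeierstrassCurve ℚ) (_ : W'.IsElliptic), W'.IsTorsionGaloisRep 5 ρ ∧
        ∃ ρ₃' : ModPGaloisRep ℚ (ZMod 3) 2, W'.IsTorsionGaloisRep 3 ρ₃' ∧
          ρ₃'.IsAbsIrreducibleOverSqrt (-3)) ↔ CDT_three_five_switch :=
  Iff.rfl

/-- The Shepherd-Barron–Taylor auxiliary curve (`BCDT.exists_isTorsionGaloisRep_five_and_surjective_three`,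
the form of `stub_switch` in reshapes 1–3) implies the registered `stub_switch` — the tree's proved
`CDT_three_five_switch_of_exists_isTorsionGaloisRep_five_and_surjective_three` (Weil-pairing determinant,
`Function.Surjective ρ̄₃ ⇒` absolute irreducibility over `ℚ(√-3)`), so EITHER discharge closes S3. [folklore] -/
theorem stub_switch_of_exists_isTorsionGaloisRep_five_and_surjective_three
    (h : exists_isTorsionGaloisRep_five_and_surjective_three) :
    ∀ (W : WeierstrassCurve ℚ) [W.IsElliptic], ¬ 27 ∣ W.conductorNorm ℤ →
      (∀ ρ₃ : ModPGaloisRep ℚ (ZMod 3) 2, W.IsTorsionGaloisRep 3 ρ₃ →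
        ¬ ρ₃.IsAbsIrreducibleOverSqrt (-3)) →
      ∀ (ρ : ModPGaloisRep ℚ (ZMod 5) 2), W.IsTorsionGaloisRep 5 ρ → ρ.IsAbsIrreducibleOverSqrt 5 →
      ∃ (W' : WeierstrassCurve ℚ) (_ : W'.IsElliptic), W'.IsTorsionGaloisRep 5 ρ ∧
        ∃ ρ₃' : ModPGaloisRep ℚ (ZMod 3) 2, W'.IsTorsionGaloisRep 3 ρ₃' ∧
          ρ₃'.IsAbsIrreducibleOverSqrt (-3) :=
  CDT_three_five_switch_of_exists_isTorsionGaloisRep_five_and_surjective_three h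

/-- **Stub S5 — the semistable branch (Serre 1972, §5.4 Prop. 21 ii), on the `16 ∣ B` Frey curves).**
For coprime `A, B` with `AB(A+B) ≠ 0`, `A ≡ −1 (mod 4)` and `16 ∣ B`, the Frey curve
`E_(A,B) : y² = x(x − A)(x + B)` is semistable at every prime (Diamond–Kramer 1995, Lemma 2: good
reduction at `2` if `16 ∥ B`, multiplicative if `32 ∣ B`; multiplicative at the odd primes dividing
`AB(A+B)`; tree: `conductorNorm_freyCurve_dvd_radical_of_sixteen_dvd`, so `N_E` is squarefree),
hence for every `Γ_ℚ`-stable subgroup `H` of `E[5]` other than `0` and `E[5]`, either `Γ_ℚ` fixes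
`H` pointwise or it acts trivially on `E[5]/H` — the tree's theorem
`WeierstrassCurve.smul_eq_or_smul_sub_mem_of_isSemistable` (stated there for a globally minimal
semistable model) transported to the Frey model along a change of variables
(`hasGlobalMinimalModel_rat_holds`).  CLOSED: landed as
`Summit.ABC.ABC.Theorems.stub_freySemistableDichotomy` (p117468). [cite: Serre1972, §5.4 Prop. 21 ii)] -/
theorem stub_freySemistableDichotomy :
    ∀ (A B : ℤ) [(freyCurve A B).IsElliptic], IsCoprime A B → A * B * (A + B) ≠ 0 →
      A ≡ -1 [ZMOD 4] → (16 : ℤ) ∣ B →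
      ∀ H : AddSubgroup (geomTorsion (freyCurve A B) (5 : ℕ)),
        (∀ σ : Field.absoluteGaloisGroup ℚ, ∀ P ∈ H, σ • P ∈ H) → H ≠ ⊥ → H ≠ ⊤ →
        (∀ σ : Field.absoluteGaloisGroup ℚ, ∀ P ∈ H, σ • P = P) ∨
          ∀ (σ : Field.absoluteGaloisGroup ℚ) (Q : geomTorsion (freyCurve A B) (5 : ℕ)),
            σ • Q - Q ∈ H :=
  fun A B _ ↦ Summit.ABC.ABC.Theorems.stub_freySemistableDichotomy A B

/-- **Stub S6 — the Swan conductor of `E[5]` above `2` is odd on the additive Frey classes**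
(Diamond–Kramer 1995, Lemma 2, `ord₂ B ∈ {1, 2, 3}`: `f₂ = 5, 3, 3`, i.e. `δ₂ = 3, 1, 1`; Galois
side: the tree's `ThreeTorsionSwanAtTwoClass…` values of `Sw_𝔓(E[3])` for the classes
`(ord₂ Δ, ord₂ c₄, ord₂ c₆) = (6,4,7), (6,4,≥8)` (`2 ∥ B`), `(8,4,6)` (`4 ∥ B`, via the `2`-isogeny
onto `(4,5,5)`, `swanConductorAt_torsion_three_freyCurve_of_four_mul`) and `(10,4,6)` (`8 ∥ B`,
`swanConductorAt_torsion_three_freyCurve_of_eight_mul`), carried from `E[3]` to `E[5]` by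
`swanConductorAt_rationalTate_eq_swanConductorAt_torsion` and the `ℓ`-independence
`swanConductorAt_rationalTate_eq_swanConductorAt_rationalTate`).  For coprime `A, B` with
`AB(A+B) ≠ 0`, `A ≡ −1 (mod 4)`, `2 ∣ B`, `16 ∤ B` and `2A + B ≠ 0` (this last condition excludes
the single curve `E_(−1,2)`, `j = 1728`, whose `c₆` vanishes), there is a prime `𝔓` of `\bar ℤ` above
`2` at which `Sw_𝔓(E[5]) = 1` or `Sw_𝔓(E[5]) = 3`.  CLOSED: landed as
`Summit.ABC.ABC.Theorems.stub_freySwanOdd` (p117514). [cite: DiamondKramer1995, Lemma 2] -/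
theorem stub_freySwanOdd :
    ∀ (A B : ℤ) [(freyCurve A B).IsElliptic], IsCoprime A B → A * B * (A + B) ≠ 0 →
      A ≡ -1 [ZMOD 4] → (2 : ℤ) ∣ B → ¬ (16 : ℤ) ∣ B → 2 * A + B ≠ 0 →
      ∃ (v : HeightOneSpectrum (𝓞 ℚ)) (𝔓 : Ideal (absIntegers (𝓞 ℚ) ℚ)),
        (2 : 𝓞 ℚ) ∈ v.asIdeal ∧ 𝔓 ∈ v.primesAbove ∧
        (((freyCurve A B).torsionGaloisRep 5).swanConductorAt (𝓞 ℚ) 𝔓 = 1 ∨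
          ((freyCurve A B).torsionGaloisRep 5).swanConductorAt (𝓞 ℚ) 𝔓 = 3) :=
  fun A B _ ↦ Summit.ABC.ABC.Theorems.stub_freySwanOdd A B

/-- **Stub S7 — a `Γ_ℚ`-stable line makes the Swan conductor of `E[5]` above `2` even**
(Diamond–Kramer 1995, Lemma 3: "`b` is integer-valued and additive on short exact sequences, so
`b(ψ) = 2 b(χ)` would be even").  For every elliptic curve `E/ℚ` and every `Γ_ℚ`-stable subgroup
`H` of `E[5]` other than `0` and `E[5]` (a stable line `𝔽₅ P` with isogeny character `r`,
`σP = r(σ)P`; quotient character `χ̄₅ r⁻¹`), at every prime `𝔓` of `\bar ℤ` above `2`: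
`Sw_𝔓(E[5]) = 2n` for some `n ∈ ℕ`.  Indeed each wild group `Γ_ℚ^u(𝔓)` (`u > 0`, a pro-`2` group on
which `χ̄₅ = det` is trivial) acts on `E[5]` trivially when `r` is trivial on it and without non-zero
fixed vector otherwise, so `codim E[5]^{Γ^u} = 2 · codim (𝔽₅P)^{Γ^u}` and `Sw_𝔓(E[5]) = 2 Sw_𝔓(r)`,
where `Sw_𝔓(r) = a_𝔓(r) − codim ∈ ℕ` by the integrality of the Artin conductor of the finite-order
character `r` (tree: `exists_natCast_eq_artinConductorAt_of_hasOpenInertiaKerAt_holds`, from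
`hasseArf_holds`).  CLOSED: landed as `Summit.ABC.ABC.Theorems.stub_swanEvenOfStableLine`.
[cite: DiamondKramer1995, Lemma 3] -/
theorem stub_swanEvenOfStableLine :
    ∀ (W : WeierstrassCurve ℚ) [W.IsElliptic] (H : AddSubgroup (geomTorsion W (5 : ℕ))),
      (∀ σ : Field.absoluteGaloisGroup ℚ, ∀ P ∈ H, σ • P ∈ H) → H ≠ ⊥ → H ≠ ⊤ →
      ∀ (v : HeightOneSpectrum (𝓞 ℚ)), (2 : 𝓞 ℚ) ∈ v.asIdeal →
      ∀ 𝔓 ∈ v.primesAbove, ∃ n : ℕ, (W.torsionGaloisRep 5).swanConductorAt (𝓞 ℚ) 𝔓 = 2 * n :=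
  fun W _ ↦ Summit.ABC.ABC.Theorems.stub_swanEvenOfStableLine W

/-- **Stub S8 (lead) — the glue: Frey rigidity at `5` from S5, S6, S7 and Kubert 1976.**  Granted the
three statements `stub_freySemistableDichotomy`, `stub_freySwanOdd`, `stub_swanEvenOfStableLine`
(as hypotheses), `ρ̄_{E,5}` is irreducible — `E[5]` has no `Γ_ℚ`-stable subgroup other than `0` and
`E[5]` — for every Frey curve `E_(a,b)`, `a, b` coprime, `ab(a+b) ≠ 0`.  Normalise (Rubin–Silverberg /
Diamond–Kramer Lemma 1): moving a `2`-torsion point to the origin (`translate_freyCurve`), swapping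
(`freyCurve_swap`) and, if the odd root has the wrong sign, twisting by `−1`
(`quadraticTwist_freyCurve_neg_one`) — all of which preserve (ir)reducibility of `E[5]`
(`hasIrreducibleModPGaloisRep_smul_iff`, the signed Galois-equivariant `E(ℚ̄) ≃ E^{(−1)}(ℚ̄)`) —
reach `A ≡ −1 (mod 4)`, `2 ∣ B`.  If `16 ∣ B`, S5 gives a rational point of order `5` on `E` or on
the `5`-isogenous quotient `E/H` (`exists_isogeny_ker_eq_and_comp_eq_nsmul_holds`), both of which have
full rational `2`-torsion, against KUBERT (`Kubert1976_no_two_ten_holds`: no `ℤ/2 × ℤ/10 ↪ E(ℚ)`).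
If `16 ∤ B` and `2A + B ≠ 0`, S6 and S7 give `2n ∈ {1, 3}`.  If `2A + B = 0` the curve is
`E_(−1,2) ≅ (y² = x³ − x)`, good and supersingular at `3` (`a₃ = 0`), so `Frob₃` has characteristic
polynomial `X² + 3`, irreducible over `𝔽₅`, and fixes no line.  CLOSED: landed as
`Summit.ABC.ABC.Theorems.stub_freyFiveIrreducibleGlue` (helpers `stub_glue_notThreeDvd` p117366,
`stub_glue_twist` p117407, `stub_glue_dichotomy` p117530). [cite: DiamondKramer1995, Lemmas 1–3] -/
theorem stub_freyFiveIrreducibleGlue :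
    (∀ (A B : ℤ) [(freyCurve A B).IsElliptic], IsCoprime A B → A * B * (A + B) ≠ 0 →
      A ≡ -1 [ZMOD 4] → (16 : ℤ) ∣ B →
      ∀ H : AddSubgroup (geomTorsion (freyCurve A B) (5 : ℕ)),
        (∀ σ : Field.absoluteGaloisGroup ℚ, ∀ P ∈ H, σ • P ∈ H) → H ≠ ⊥ → H ≠ ⊤ →
        (∀ σ : Field.absoluteGaloisGroup ℚ, ∀ P ∈ H, σ • P = P) ∨
          ∀ (σ : Field.absoluteGaloisGroup ℚ) (Q : geomTorsion (freyCurve A B) (5 : ℕ)),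
            σ • Q - Q ∈ H) →
    (∀ (A B : ℤ) [(freyCurve A B).IsElliptic], IsCoprime A B → A * B * (A + B) ≠ 0 →
      A ≡ -1 [ZMOD 4] → (2 : ℤ) ∣ B → ¬ (16 : ℤ) ∣ B → 2 * A + B ≠ 0 →
      ∃ (v : HeightOneSpectrum (𝓞 ℚ)) (𝔓 : Ideal (absIntegers (𝓞 ℚ) ℚ)),
        (2 : 𝓞 ℚ) ∈ v.asIdeal ∧ 𝔓 ∈ v.primesAbove ∧
        (((freyCurve A B).torsionGaloisRep 5).swanConductorAt (𝓞 ℚ) 𝔓 = 1 ∨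
          ((freyCurve A B).torsionGaloisRep 5).swanConductorAt (𝓞 ℚ) 𝔓 = 3)) →
    (∀ (W : WeierstrassCurve ℚ) [W.IsElliptic] (H : AddSubgroup (geomTorsion W (5 : ℕ))),
      (∀ σ : Field.absoluteGaloisGroup ℚ, ∀ P ∈ H, σ • P ∈ H) → H ≠ ⊥ → H ≠ ⊤ →
      ∀ (v : HeightOneSpectrum (𝓞 ℚ)), (2 : 𝓞 ℚ) ∈ v.asIdeal →
      ∀ 𝔓 ∈ v.primesAbove, ∃ n : ℕ, (W.torsionGaloisRep 5).swanConductorAt (𝓞 ℚ) 𝔓 = 2 * n) →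
    ∀ a b : ℤ, IsCoprime a b → a * b * (a + b) ≠ 0 →
      (freyCurve a b).HasIrreducibleModPGaloisRep 5 :=
  Summit.ABC.ABC.Theorems.stub_freyFiveIrreducibleGlue

/-!
### Reshape 6 (lead `c50`): the scope of the `3`–`5` switch on the Frey family — side stubs S11, S12

Case B of `isModular_freyCurve_of_stubs` (no framed model of `E[3]` absolutely irreducible over
`ℚ(√-3)`; the only place where `stub_switch` and `stub_liftFive` are consumed) is EMPTY on the
additive Frey classes: after the normalisation `A ≡ -1 (mod 4)`, `2 ∣ B`, case B forces `16 ∣ B`,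
i.e. the Frey curve is semistable at every prime (Diamond–Kramer 1995, Lemma 2 and the remark after
Lemma 3; Ribet 1997, proof of Prop. 1: "the action of `I` on `E[l]` is irreducible").  Proof: on
the additive classes the Swan conductor of `E[5]` (= that of `E[3]`) above `2` is ODD (S6,
`stub_freySwanOdd`), an odd Swan conductor makes the inertia action on `E[3]` non-abelian (S11:
`det = χ̄₃` is unramified at `2`, every non-trivial wild group fixes nothing, `Sw = 2 φ(b)`, and
Hasse–Arf makes `φ(b)` an integer when inertia acts through an abelian group), a non-abelian
subgroup of `SL₂(𝔽₃)` is quaternion and together with complex conjugation yields an element of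
order `8` in the image of `ρ̄_{E,3}`, which forces absolute irreducibility over `ℚ(√-3)`
(`isAbsIrreducibleOverSqrt_negThree_of_orderOf_eq_eight`, landed with R3); the corner `2A + B = 0`
is `E_(-1,2)` with `3 ∤ abc` (R3, `isAbsIrreducibleOverSqrt_negThree_freyCurve_of_not_three_dvd`).
So the switch (S3) and the lifting theorem at `5` (S2) are needed only for SEMISTABLE Frey curves
with `ρ̄_{E,3}` reducible — Wiles' original setting (1995, Ch. 5).  These stubs (and S13, the
unconditional CM corner) are side results: they do not feed `FreyModularity_of`, whose atoms
S1a/S1b/S2/S9/S3 are unchanged (a semistable re-cut of S3 would need twist invariance of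
`BCDT.IsModular` for the un-normalised pairs, which the tree lacks); they record the exact scope of
case B for the planners.  S11 CLOSED (p157517), S12 CLOSED (p158268), S13 CLOSED (p158543).
-/

/-- **Stub S11 — an odd Swan conductor of `E[3]` above `2` makes the inertia action on `E[3]`
non-abelian** (Diamond–Kramer 1995, Lemma 3, run for the inertia group: `det ρ̄_{E,3} = χ̄₃` is
unramified at `2`, so inertia acts through `SL₂(𝔽₃)`, every non-trivial wild ramification group
contains `-1` and fixes nothing, `Sw_𝔓(E[3]) = 2 φ_{L/ℚ}(b)` for `L = ℚ(E[3])` and the break `b`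
of the central involution; if inertia acted through an abelian group, Hasse–Arf would make `φ(b)`
an integer and the Swan conductor even).  For `E/ℚ` elliptic, `v ∋ 2`, `𝔓 ∣ v`: if `Sw_𝔓(E[3])`
is not of the form `2n` then some `σ₁, σ₂ ∈ I_𝔓` act on `E[3]` without commuting.  CLOSED by
lead `c50`: `Summit.ABC.ABC.Theorems.stub_swanOddNonabelianInertia`
(`Theorems/DefiniteXiFreyModularityStubSwanOddNonabelian.lean`, p157517). [cite: DiamondKramer1995, Lemma 3] -/
theorem stub_swanOddNonabelianInertia :
    ∀ (W : WeierstrassCurve ℚ) [W.IsElliptic] (v : HeightOneSpectrum (𝓞 ℚ)),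
      (2 : 𝓞 ℚ) ∈ v.asIdeal → ∀ 𝔓 ∈ v.primesAbove,
      (¬ ∃ n : ℕ, (W.torsionGaloisRep 3).swanConductorAt (𝓞 ℚ) 𝔓 = 2 * n) →
      ∃ σ₁ ∈ 𝔓.inertia (Field.absoluteGaloisGroup ℚ), ∃ σ₂ ∈ 𝔓.inertia (Field.absoluteGaloisGroup ℚ),
        ∃ T : geomTorsion W (3 : ℕ), (σ₁ * σ₂) • T ≠ (σ₂ * σ₁) • T :=
  fun W _ ↦ Summit.ABC.ABC.Theorems.stub_swanOddNonabelianInertia W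

/-- **Stub S12 — case B forces `16 ∣ B` (the additive Frey classes are in case A).**  For coprime
`A, B` with `AB(A+B) ≠ 0`, `A ≡ -1 (mod 4)`, `2 ∣ B`: if no framed model of `E_(A,B)[3]` is
absolutely irreducible over `ℚ(√-3)` then `16 ∣ B` (so `E_(A,B)` is semistable at every prime,
`N_E = rad(AB(A+B))`).  From S6 (`stub_freySwanOdd`: Swan `1` or `3` on the classes
`ord₂ B ∈ {1,2,3}`, `2A + B ≠ 0`), the `ℓ`-independence of the Swan conductor, S11, the group
theory of `GL₂(𝔽₃)` (a non-abelian subgroup of `SL₂(𝔽₃)` is quaternion; with an element of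
determinant `-1` it produces an element of order `8`), R3's criterion
`isAbsIrreducibleOverSqrt_negThree_of_orderOf_eq_eight`, and R3 itself on the corner `2A + B = 0`
(`E_(-1,2)`, `3 ∤ abc`).  CLOSED by lead `c50`: `Summit.ABC.ABC.Theorems.stub_freyCaseBSixteen`
(`Theorems/DefiniteXiFreyModularityStubFreyCaseBSixteen.lean`, p158268).
[cite: DiamondKramer1995, Lemma 2 and remark after Lemma 3]
[cite: Ribet1997, Prop. 1 (proof, pp. 11–12)] -/
theorem stub_freyCaseBSixteen :
    ∀ (A B : ℤ) [(freyCurve A B).IsElliptic], IsCoprime A B → A * B * (A + B) ≠ 0 →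
      A ≡ -1 [ZMOD 4] → (2 : ℤ) ∣ B →
      (∀ ρ₃ : ModPGaloisRep ℚ (ZMod 3) 2, (freyCurve A B).IsTorsionGaloisRep 3 ρ₃ →
        ¬ ρ₃.IsAbsIrreducibleOverSqrt (-3)) →
      (16 : ℤ) ∣ B :=
  fun A B _ ↦ Summit.ABC.ABC.Theorems.stub_freyCaseBSixteen A B

/-- **Stub S13 — the crux holds, unconditionally, at the CM corner `(a, b) = (1, -2)`.**  The body
of `FreyModularity` at the corner pair `(1, -2)` (`ab(a+b) = 2`): for every level `N` with
`N_{E_(1,-2)} = N`, the Frey curve `E_(1,-2) : y² = x(x - 1)(x - 2)` carries a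
`ModularParametrizationData` at level `N`.  It is the translate `x ↦ x + 1` of the congruent number
curve `E₁ : y² = x³ - x`, modular in the sense of BCDT (2) by the tree's newform
`η(4z)²η(8z)² ∈ S₂(Γ₀(32))` (`exists_isNewformOf_congruentNumberCurve_one`, `N(E₁) = 32`), and a
newform is a datum (`nonempty_modularParametrizationData_iff_isModularAt`).  So the datum type of
the crux is inhabited in kind for a Frey curve (the six CM pairs `{|a|,|b|,|a+b|} = {1,1,2}` need no
lifting theorem).  Side stub (does not feed `FreyModularity_of`).  CLOSED by lead `c50`:
`Summit.ABC.ABC.Theorems.stub_freyModularityCorner` (`Theorems/DefiniteXiFreyModularityStubCorner.lean`,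
p158543). [cite: Tunnell1983Congruent, p. 325] -/
theorem stub_freyModularityCorner :
    ∀ (N : ℕ) [NeZero N], (freyCurve 1 (-2)).conductorNorm ℤ = N →
      Nonempty (ModularParametrizationData (freyCurve 1 (-2)) N) :=
  fun N _ ↦ Summit.ABC.ABC.Theorems.stub_freyModularityCorner N

/-!
### Reshape 7 (lead `c52`): the exact shape of case B — side stubs S14, S15, S18

With S12 (`16 ∣ B`), case B of `isModular_freyCurve_of_stubs` on the normalised Frey family is
pinned down completely by THEOREMS of the tree: Serre 1972, §5.4 Prop. 21 (= Edixhoven 1997,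
Prop. 2.1, PROVED as `Edixhoven1997_prop_2_1_holds`) says that for a semistable `E/ℚ` the mod-`3`
representation is onto `GL₂(𝔽₃)` — impossible in case B, an onto `ρ̄_{E,3}` being absolutely
irreducible on `Γ_{ℚ(√-3)}` (`isAbsIrreducibleOverSqrt_neg_three_of_surjective`) — or REDUCIBLE
with semi-simplification `1 ⊕ χ̄₃` (S14); and R3 (`3 ∤ abc` ⇒ case A) gives `3 ∣ abc`, i.e.
multiplicative reduction at `3` (S15).  So a case-B Frey curve is semistable, multiplicative
(ordinary) at `3`, with `ρ̄_{E,3}^{ss} = 1 ⊕ χ̄₃`: Wiles' original setting of the `3`–`5` switch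
(1995, Ch. 5) and, verbatim, the hypotheses of the residually reducible ordinary lifting theorem of
Skinner–Wiles 1999 at `p = 3` (crux idea `single-prime-three`: the switch-free architecture's
case split is now kernel-exact).  S18 records that case B is INHABITED on the semistable class
(the `abc`-triple `5 + 27 = 32`: `E_(-5,32) : y² = x(x+5)(x+32)` carries the rational point
`(4, 36)` of order `3`), so `stub_switch` is genuinely consumed by `FreyModularity_of`.  Side
stubs: they do not feed `FreyModularity_of`; the five atoms are unchanged.
-/

/-- **Stub S14 — in case B, `ρ̄_{E,3}` is reducible with semi-simplification `1 ⊕ χ̄₃`** (Serre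
1972, §5.4 Prop. 21 ii) on the semistable Frey curves; Edixhoven 1997, Prop. 2.1).  For coprime
`A, B` with `AB(A+B) ≠ 0`, `A ≡ -1 (mod 4)`, `2 ∣ B`: if no framed model of `E_(A,B)[3]` is
absolutely irreducible over `ℚ(√-3)`, then `E[3]` has a `Γ_ℚ`-stable subgroup `H ≠ 0, E[3]`
fixed pointwise by `Γ_ℚ` or with `Γ_ℚ` acting trivially on `E[3]/H`.  Proof: S12 gives `16 ∣ B`,
so `E` is semistable (`isSemistable_freyCurve_of_sixteen_dvd`); by Prop. 21
(`Edixhoven1997_prop_2_1_holds`) `ρ̄_{E,3}` is onto or has such a line, and onto is case A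
(`surjective_of_hasSurjectiveModNGaloisRep`, `isAbsIrreducibleOverSqrt_neg_three_of_surjective`).
CLOSED by lead `c52`: `Summit.ABC.ABC.Theorems.stub_freyCaseBThreeReducible`
(`Theorems/DefiniteXiFreyModularityStubFreyCaseBThreeReducible.lean`, p163490).
[cite: Serre1972, §5.4 Prop. 21] [cite: Edixhoven1997, Prop. 2.1 (PDF p. 285)] -/
theorem stub_freyCaseBThreeReducible :
    ∀ (A B : ℤ) [(freyCurve A B).IsElliptic], IsCoprime A B → A * B * (A + B) ≠ 0 →
      A ≡ -1 [ZMOD 4] → (2 : ℤ) ∣ B →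
      (∀ ρ₃ : ModPGaloisRep ℚ (ZMod 3) 2, (freyCurve A B).IsTorsionGaloisRep 3 ρ₃ →
        ¬ ρ₃.IsAbsIrreducibleOverSqrt (-3)) →
      ∃ H : AddSubgroup (geomTorsion (freyCurve A B) (3 : ℕ)),
        (∀ σ : Field.absoluteGaloisGroup ℚ, ∀ P ∈ H, σ • P ∈ H) ∧ H ≠ ⊥ ∧ H ≠ ⊤ ∧
        ((∀ σ : Field.absoluteGaloisGroup ℚ, ∀ P ∈ H, σ • P = P) ∨
          ∀ (σ : Field.absoluteGaloisGroup ℚ) (Q : geomTorsion (freyCurve A B) (3 : ℕ)),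
            σ • Q - Q ∈ H) :=
  fun A B _ ↦ Summit.ABC.ABC.Theorems.stub_freyCaseBThreeReducible A B

/-- **Stub S15 — in case B, `3 ∣ ab(a+b)` and `E_(a,b)` is multiplicative at `3`** (no
normalisation needed).  For coprime `a, b` with `ab(a+b) ≠ 0`: if no framed model of
`E_(a,b)[3]` is absolutely irreducible over `ℚ(√-3)`, then `3 ∣ ab(a+b)` — otherwise `E_(a,b)` is
good supersingular at `3` and R3 (`isAbsIrreducibleOverSqrt_negThree_freyCurve_of_not_three_dvd`)
puts it in case A — hence multiplicative reduction at the place `3`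
(`hasMultiplicativeReductionAt_freyCurve_of_ne_two`): `ρ_{E,3}` is ordinary at `3`.  CLOSED by
lead `c52`: `Summit.ABC.ABC.Theorems.stub_freyCaseBMultiplicativeThree` (same file as S14, p163490).
[cite: DiamondKramer1995, Lemma 2] [cite: SkinnerWiles1999, Theorem (Introduction)] -/
theorem stub_freyCaseBMultiplicativeThree :
    ∀ (a b : ℤ) [(freyCurve a b).IsElliptic], IsCoprime a b → a * b * (a + b) ≠ 0 →
      (∀ ρ₃ : ModPGaloisRep ℚ (ZMod 3) 2, (freyCurve a b).IsTorsionGaloisRep 3 ρ₃ →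
        ¬ ρ₃.IsAbsIrreducibleOverSqrt (-3)) →
      (3 : ℤ) ∣ a * b * (a + b) ∧
        ∀ v : HeightOneSpectrum ℤ, Rat.HeightOneSpectrum.natGenerator v = 3 →
          (freyCurve a b).HasMultiplicativeReductionAt v :=
  fun a b _ ↦ Summit.ABC.ABC.Theorems.stub_freyCaseBMultiplicativeThree a b

/-- **Stub S18 — case B is inhabited on the semistable Frey class: the triple `5 + 27 = 32`.**
The pair `(a, b) = (-5, 32)` is coprime and normalised (`-5 ≡ -1 (mod 4)`, `16 ∣ 32`), and the
Frey curve `E_(-5,32) : y² = x(x+5)(x+32)` (conductor `30`) carries the rational point `(4, 36)`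
of order `3` (tangent slope `7` at `(4, 36)`: `2(4,36) = (4,-36)`), so `E[3]` has the
`Γ_ℚ`-stable line it generates (`not_hasIrreducibleModPGaloisRep_of_addOrderOf_eq`), every framed
model of `E[3]` is reducible (`hasIrreducibleModPGaloisRep_of_isIrreducible`, landed with the
crux's Negative files) and none is absolutely irreducible over `ℚ(√-3)`
(`IsAbsIrreducibleOverSqrt.isAbsolutelyIrreducible`, `.isIrreducible`): the hypotheses of S14 and
of the case-B branch of `isModular_freyCurve_of_stubs` are jointly satisfiable, i.e. `stub_switch`
is consumed by `FreyModularity_of` (the architecture cannot be trimmed by emptiness of case B; cf.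
the Kubert `ℤ/2 × ℤ/6` family).  CLOSED (lead `c52`'s wave, stub-worker):
`Summit.ABC.ABC.Theorems.stub_freyCaseBWitness`
(`Theorems/DefiniteXiFreyModularityStubFreyCaseBWitness.lean`, p163711). [folklore] -/
theorem stub_freyCaseBWitness :
    IsCoprime (-5 : ℤ) 32 ∧ (-5 : ℤ) * 32 * (-5 + 32) ≠ 0 ∧ (-5 : ℤ) ≡ -1 [ZMOD 4] ∧
      (16 : ℤ) ∣ 32 ∧
      ∀ ρ₃ : ModPGaloisRep ℚ (ZMod 3) 2, (freyCurve (-5) 32).IsTorsionGaloisRep 3 ρ₃ →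
        ¬ ρ₃.IsAbsIrreducibleOverSqrt (-3) :=
  Summit.ABC.ABC.Theorems.stub_freyCaseBWitness

/-- **Stub S17 — in case B, `ρ̄_{E,3}` is reducible for EVERY Frey curve** (no normalisation).
For coprime `a, b` with `ab(a+b) ≠ 0`: if no framed model of `E_(a,b)[3]` is absolutely
irreducible over `ℚ(√-3)`, then `E_(a,b)[3]` has a `Γ_ℚ`-stable subgroup other than `0` and
`E[3]` (`E_(a,b)` admits a rational `3`-isogeny).  From S14 on the normalised presentation, case B
being carried along translations (isomorphic curves have the same framed models) and along the
`−1` twist `E_(b,a) = E_(a,b)^{(−1)}` by the framed twist model `E^{(d)}[p] ≅ ρ̄ ⊗ χ_d`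
(`Literature/NumberTheory/EllipticCurves/QuadraticTwistFramedTorsion.lean`, landed for this
purpose, p164802) and the twist-invariance of absolute irreducibility over `ℚ(√-3)`.  Side stub;
does not feed `FreyModularity_of`.  CLOSED by lead `c52`:
`Summit.ABC.ABC.Theorems.stub_freyCaseBThreeReducibleAll`
(`Theorems/DefiniteXiFreyModularityStubFreyCaseBAllPairs.lean`, p165224).
[cite: Serre1972, §5.4 Prop. 21] [cite: DiamondKramer1995, Lemma 1] -/
theorem stub_freyCaseBThreeReducibleAll :
    ∀ (a b : ℤ) [(freyCurve a b).IsElliptic], IsCoprime a b → a * b * (a + b) ≠ 0 →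
      (∀ ρ₃ : ModPGaloisRep ℚ (ZMod 3) 2, (freyCurve a b).IsTorsionGaloisRep 3 ρ₃ →
        ¬ ρ₃.IsAbsIrreducibleOverSqrt (-3)) →
      ¬ (freyCurve a b).HasIrreducibleModPGaloisRep 3 :=
  fun a b _ ↦ Summit.ABC.ABC.Theorems.stub_freyCaseBThreeReducibleAll a b

-- Stub S4b `stub_absIrrSqrtFive` (Rubin's Prop. 7) is CLOSED: landed as
-- `Summit.ABC.ABC.Theorems.stub_absIrrSqrtFive` (p102499) and used by name in `FreyModularity_of`.

-- Stub `stub_nineTransfer` (Silverberg's Prop. 7.1 at 3) is CLOSED: landed as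
-- `Summit.ABC.ABC.Theorems.stub_nineTransfer` (p110220) and used by name in `FreyModularity_of`.

/-! ## Glue (proved) -/

/-- **Modularity at `3` for curves semistable at `3`, the composite shape of reshapes 1–4** (CDT
Thm. 7.2.1 restricted to `9 ∤ N`), PROVED from the atoms S1a, S1b, S9 exactly as the tree proves
`CDT_theorem_7_2_1_of_modThree_of_lift_of_three_imp_two`: `ρ̄|ℚ(√-3)` absolutely irreducible makes `ρ̄`
absolutely irreducible (`IsAbsIrreducibleOverSqrt.isAbsolutelyIrreducible`), hence modular (S1a); then
`ρ_{E,3}` is modular (S1b) and `E` is modular (S9 at `ℓ = 3`).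
[cite: ConradDiamondTaylor1999, Thm. 7.2.1 (proof, p. 553)] -/
theorem liftThree_of_stubs
    (hmod3 : ∀ (W : WeierstrassCurve ℚ) [W.IsElliptic] (ρ : ModPGaloisRep ℚ (ZMod 3) 2),
      W.IsTorsionGaloisRep 3 ρ → FramedRep.IsAbsolutelyIrreducible ρ → ρ.IsModular)
    (hlift3 : ∀ (W : WeierstrassCurve ℚ) [W.IsElliptic] (ρ : ModPGaloisRep ℚ (ZMod 3) 2),
      W.IsTorsionGaloisRep 3 ρ → ρ.IsAbsIrreducibleOverSqrt (-3) → ¬ 9 ∣ W.conductorNorm ℤ →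
      ρ.IsModular → W.IsModularGaloisRepTate 3)
    (h32 : ∀ (W : WeierstrassCurve ℚ) [W.IsElliptic] [NeZero (W.conductorNorm ℤ)] (ℓ : ℕ)
      [Fact ℓ.Prime], W.IsModularGaloisRepTate ℓ → BCDT.IsModular W) :
    ∀ (W : WeierstrassCurve ℚ) [W.IsElliptic] [NeZero (W.conductorNorm ℤ)]
      (ρ : ModPGaloisRep ℚ (ZMod 3) 2), W.IsTorsionGaloisRep 3 ρ →
      ρ.IsAbsIrreducibleOverSqrt (-3) → ¬ 9 ∣ W.conductorNorm ℤ → BCDT.IsModular W :=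
  fun W _ _ ρ hρ hirr h9 ↦
    h32 W 3 (hlift3 W ρ hρ hirr h9 (hmod3 W ρ hρ hirr.isAbsolutelyIrreducible))

/-- **Modularity at `5` for curves semistable at `5`, the composite shape of reshapes 1–4** (CDT
Thm. 7.2.2 restricted to `25 ∤ N`), PROVED from the atoms S2, S9 as the tree proves
`CDT_theorem_7_2_2_of_lift_of_three_imp_two`. [cite: ConradDiamondTaylor1999, Thm. 7.2.2 (proof, pp. 553–554)] -/
theorem liftFive_of_stubs
    (hlift5 : ∀ (W : WeierstrassCurve ℚ) [W.IsElliptic] (ρ : ModPGaloisRep ℚ (ZMod 5) 2),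
      W.IsTorsionGaloisRep 5 ρ → ρ.IsAbsIrreducibleOverSqrt 5 → ¬ 25 ∣ W.conductorNorm ℤ →
      ρ.IsModular → W.IsModularGaloisRepTate 5)
    (h32 : ∀ (W : WeierstrassCurve ℚ) [W.IsElliptic] [NeZero (W.conductorNorm ℤ)] (ℓ : ℕ)
      [Fact ℓ.Prime], W.IsModularGaloisRepTate ℓ → BCDT.IsModular W) :
    ∀ (W : WeierstrassCurve ℚ) [W.IsElliptic] [NeZero (W.conductorNorm ℤ)],
      ¬ 25 ∣ W.conductorNorm ℤ →
      ∀ (ρ : ModPGaloisRep ℚ (ZMod 5) 2), W.IsTorsionGaloisRep 5 ρ →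
      ρ.IsAbsIrreducibleOverSqrt 5 → ρ.IsModular → BCDT.IsModular W :=
  fun W _ _ h25 ρ hρ hirr hmod ↦ h32 W 5 (hlift5 W ρ hρ hirr h25 hmod)

/-! ### Which catalogued facts close which atom (kernel-checked pointers; EITHER side closes the stub) -/

/-- S1a is the tree's `modThree_of_langlands_tunnell` granted `langlands_tunnell` for every `σ`.
[cite: Wiles1995Annals, Ch. 5] -/
theorem stub_modThree_of_langlands_tunnell
    (hLT : ∀ σ : FramedArtinRep ℚ 2, Literature.NumberTheory.Automorphic.langlands_tunnell σ) :
    ∀ (W : WeierstrassCurve ℚ) [W.IsElliptic] (ρ : ModPGaloisRep ℚ (ZMod 3) 2),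
      W.IsTorsionGaloisRep 3 ρ → FramedRep.IsAbsolutelyIrreducible ρ → ρ.IsModular :=
  modThree_of_langlands_tunnell hLT

/-- S1b is implied by the catalogued `BCDT.CDT_theorem_7_2_1` (`lift_three_of_CDT_theorem_7_2_1`;
`9 ∣ 27`). [folklore] -/
theorem stub_liftThree_of_CDT_theorem_7_2_1 (h : CDT_theorem_7_2_1) :
    ∀ (W : WeierstrassCurve ℚ) [W.IsElliptic] (ρ : ModPGaloisRep ℚ (ZMod 3) 2),
      W.IsTorsionGaloisRep 3 ρ → ρ.IsAbsIrreducibleOverSqrt (-3) → ¬ 9 ∣ W.conductorNorm ℤ →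
      ρ.IsModular → W.IsModularGaloisRepTate 3 :=
  fun W _ ρ hρ hirr h9 _ ↦
    lift_three_of_CDT_theorem_7_2_1 h W ρ hρ hirr fun h27 ↦ h9 (dvd_trans ⟨3, rfl⟩ h27)

/-- S2 is implied by the catalogued `BCDT.CDT_theorem_7_2_2` (`lift_of_CDT_theorem_7_2_2`). [folklore] -/
theorem stub_liftFive_of_CDT_theorem_7_2_2 (h : CDT_theorem_7_2_2) :
    ∀ (W : WeierstrassCurve ℚ) [W.IsElliptic] (ρ : ModPGaloisRep ℚ (ZMod 5) 2),
      W.IsTorsionGaloisRep 5 ρ → ρ.IsAbsIrreducibleOverSqrt 5 → ¬ 25 ∣ W.conductorNorm ℤ →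
      ρ.IsModular → W.IsModularGaloisRepTate 5 :=
  fun W _ ρ hρ hirr _ hmod ↦ lift_of_CDT_theorem_7_2_2 h W ρ hρ hirr hmod

/-- S9 is the tree's `isModular_of_isModularGaloisRepTate_of_two_facts` granted Eichler–Shimura and
Carayol ONLY — Faltings' isogeny theorem being a theorem of the tree
(`WeierstrassCurve.isIsogenous_iff_frobeniusTrace_eq_holds`). [cite: BCDTJAMS2001, Introduction ((3) ⇒ (2))] -/
theorem stub_threeImpTwo_of_two_facts
    (hES : Literature.NumberTheory.EllipticCurves.ModularForms.eichlerShimuraConstruction)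
    (hC : ∀ (N : ℕ) [NeZero N],
      Literature.NumberTheory.EllipticCurves.ModularForms.IsNewformOf.level_eq_conductorNorm (N := N)) :
    ∀ (W : WeierstrassCurve ℚ) [W.IsElliptic] [NeZero (W.conductorNorm ℤ)] (ℓ : ℕ) [Fact ℓ.Prime],
      W.IsModularGaloisRepTate ℓ → BCDT.IsModular W :=
  fun W _ _ ℓ _ h ↦ isModular_of_isModularGaloisRepTate_of_two_facts hES hC W ℓ h

/-- **`ρ̄_{E,5}` is irreducible for every Frey curve** (`a, b` coprime, `ab(a+b) ≠ 0`): the four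
stubs S5–S8 composed. [cite: DiamondKramer1995, Lemmas 1–3] -/
theorem hasIrreducibleModPGaloisRep_freyCurve_five {a b : ℤ} (hab : IsCoprime a b)
    (h0 : a * b * (a + b) ≠ 0) : (freyCurve a b).HasIrreducibleModPGaloisRep 5 :=
  stub_freyFiveIrreducibleGlue
    (fun A B _ ↦ stub_freySemistableDichotomy A B)
    (fun A B _ ↦ stub_freySwanOdd A B)
    (fun W _ ↦ stub_swanEvenOfStableLine W) a b hab h0

/-- **Frey rigidity at `5` in the framed vocabulary of the composition**: every framed model `ρ̄` of
`E_(a,b)[5]` is irreducible (`BCDT.isIrreducible_of_hasIrreducibleModPGaloisRep`).  This is the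
hypothesis `h4a` of `isModular_freyCurve_of_stubs`, formerly supplied by the `X₀(20)` stub.
[cite: DiamondKramer1995, Lemmas 1–3] -/
theorem isIrreducible_freyCurve_five :
    ∀ a b : ℤ, IsCoprime a b → a * b * (a + b) ≠ 0 →
      ∀ ρ : ModPGaloisRep ℚ (ZMod 5) 2, (freyCurve a b).IsTorsionGaloisRep 5 ρ →
        FramedRep.IsIrreducible ρ := by
  intro a b hab h0 ρ hρ
  haveI := isElliptic_freyCurve h0
  exact isIrreducible_of_hasIrreducibleModPGaloisRep (hasIrreducibleModPGaloisRep_freyCurve_five hab h0) hρ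

/-- **The conductor of a Frey curve is not divisible by `25`.**  For coprime `a, b` with
`ab(a+b) ≠ 0`, `N_{E_(a,b)} ∣ 2⁸ · rad(ab(a+b))` (`conductorNorm_freyCurve_dvd_holds`) and the radical
is squarefree, so `25 = 5 · 5` cannot divide `N`.  Same proof as
`Summit.ABC.ABC.Theorems.not_nine_dvd_conductorNorm_freyCurve`. [cite: BombieriGubler2006, Ex. 12.5.10] -/
theorem not_twentyFive_dvd_conductorNorm_freyCurve {a b : ℤ} (hab : IsCoprime a b)
    (h0 : a * b * (a + b) ≠ 0) : ¬ 25 ∣ (freyCurve a b).conductorNorm ℤ := by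
  intro h25
  have hdvd := conductorNorm_freyCurve_dvd_holds a b hab h0
  have h25' : 25 ∣ 2 ^ 8 * (UniqueFactorizationMonoid.radical (a * b * (a + b))).natAbs :=
    h25.trans hdvd
  have hcop : Nat.Coprime 25 (2 ^ 8) := by norm_num
  have h25r : 25 ∣ (UniqueFactorizationMonoid.radical (a * b * (a + b))).natAbs :=
    hcop.dvd_of_dvd_mul_left h25'
  have hsq : Squarefree (UniqueFactorizationMonoid.radical (a * b * (a + b))).natAbs :=
    Int.squarefree_natAbs.mpr UniqueFactorizationMonoid.squarefree_radical
  have h5 : IsUnit (5 : ℕ) := hsq 5 ((show (5 : ℕ) * 5 = 25 by norm_num) ▸ h25r)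
  exact absurd (Nat.isUnit_iff.mp h5) (by norm_num)

/-- **Every Frey curve is modular, from the stub statements** — the case analysis of CDT 1999, proof of
Thm. 7.1.2 (p. 556), run on a Frey curve with the Frey-specific inputs: case A, some framed model of
`E[3]` absolutely irreducible over `ℚ(√-3)`: `stub_liftThree` (`9 ∤ N`); case B, none is: `ρ̄_{E,5}`
irreducible (`h4a`; in `FreyModularity_of`: `isIrreducible_freyCurve_five`), absolutely irreducible
over `ℚ(√5)` (`stub_absIrrSqrtFive`, `25 ∤ N`), Wiles' switch from `E` itself (`stub_switch`, fed
`27 ∤ N` from `9 ∤ N` and the negation of case A), `9 ∤ N_{E'}` (`stub_nineTransfer`), `E'` modular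
(`stub_liftThree` on the framed `ρ̄_{E',3}` absolutely irreducible over `ℚ(√-3)` the switch provides),
`ρ̄_{E,5}` modular (tree), `E` modular (`stub_liftFive`).
[cite: ConradDiamondTaylor1999, Thm. 7.1.2 (proof, p. 556)] -/
theorem isModular_freyCurve_of_stubs
    (h1 : ∀ (W : WeierstrassCurve ℚ) [W.IsElliptic] [NeZero (W.conductorNorm ℤ)]
      (ρ : ModPGaloisRep ℚ (ZMod 3) 2), W.IsTorsionGaloisRep 3 ρ →
      ρ.IsAbsIrreducibleOverSqrt (-3) → ¬ 9 ∣ W.conductorNorm ℤ → BCDT.IsModular W)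
    (h2 : ∀ (W : WeierstrassCurve ℚ) [W.IsElliptic] [NeZero (W.conductorNorm ℤ)],
      ¬ 25 ∣ W.conductorNorm ℤ →
      ∀ (ρ : ModPGaloisRep ℚ (ZMod 5) 2), W.IsTorsionGaloisRep 5 ρ →
      ρ.IsAbsIrreducibleOverSqrt 5 → ρ.IsModular → BCDT.IsModular W)
    (h3 : ∀ (W : WeierstrassCurve ℚ) [W.IsElliptic], ¬ 27 ∣ W.conductorNorm ℤ →
      (∀ ρ₃ : ModPGaloisRep ℚ (ZMod 3) 2, W.IsTorsionGaloisRep 3 ρ₃ →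
        ¬ ρ₃.IsAbsIrreducibleOverSqrt (-3)) →
      ∀ (ρ : ModPGaloisRep ℚ (ZMod 5) 2), W.IsTorsionGaloisRep 5 ρ → ρ.IsAbsIrreducibleOverSqrt 5 →
      ∃ (W' : WeierstrassCurve ℚ) (_ : W'.IsElliptic), W'.IsTorsionGaloisRep 5 ρ ∧
        ∃ ρ₃' : ModPGaloisRep ℚ (ZMod 3) 2, W'.IsTorsionGaloisRep 3 ρ₃' ∧
          ρ₃'.IsAbsIrreducibleOverSqrt (-3))
    (h4a : ∀ a b : ℤ, IsCoprime a b → a * b * (a + b) ≠ 0 →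
      ∀ ρ : ModPGaloisRep ℚ (ZMod 5) 2, (freyCurve a b).IsTorsionGaloisRep 5 ρ →
        FramedRep.IsIrreducible ρ)
    (h4b : ∀ (W : WeierstrassCurve ℚ) [W.IsElliptic], ¬ 25 ∣ W.conductorNorm ℤ →
      ∀ ρ : ModPGaloisRep ℚ (ZMod 5) 2, W.IsTorsionGaloisRep 5 ρ →
        FramedRep.IsIrreducible ρ → ρ.IsAbsIrreducibleOverSqrt 5)
    (h6 : ∀ (W W' : WeierstrassCurve ℚ) [W.IsElliptic] [W'.IsElliptic]
      (ρ : ModPGaloisRep ℚ (ZMod 5) 2),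
      W.IsTorsionGaloisRep 5 ρ → W'.IsTorsionGaloisRep 5 ρ →
      ¬ 9 ∣ W.conductorNorm ℤ → ¬ 9 ∣ W'.conductorNorm ℤ)
    {a b : ℤ} (hab : IsCoprime a b) (h0 : a * b * (a + b) ≠ 0)
    [NeZero ((freyCurve a b).conductorNorm ℤ)] : BCDT.IsModular (freyCurve a b) := by
  haveI := isElliptic_freyCurve h0
  have h9 : ¬ 9 ∣ (freyCurve a b).conductorNorm ℤ :=
    Summit.ABC.ABC.Theorems.not_nine_dvd_conductorNorm_freyCurve hab h0
  have h25 : ¬ 25 ∣ (freyCurve a b).conductorNorm ℤ := not_twentyFive_dvd_conductorNorm_freyCurve hab h0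
  -- case A: some framed model of `E[3]` is absolutely irreducible over `ℚ(√-3)`
  by_cases hA : ∃ ρ₃ : ModPGaloisRep ℚ (ZMod 3) 2,
      (freyCurve a b).IsTorsionGaloisRep 3 ρ₃ ∧ ρ₃.IsAbsIrreducibleOverSqrt (-3)
  · obtain ⟨ρ₃, hρ₃, h3i⟩ := hA
    exact h1 (freyCurve a b) ρ₃ hρ₃ h3i h9
  -- case B: no framed model of `E[3]` is absolutely irreducible over `ℚ(√-3)`; work at `5`
  have hB : ∀ ρ₃ : ModPGaloisRep ℚ (ZMod 3) 2, (freyCurve a b).IsTorsionGaloisRep 3 ρ₃ →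
      ¬ ρ₃.IsAbsIrreducibleOverSqrt (-3) := fun ρ₃ hρ₃ h3i ↦ hA ⟨ρ₃, hρ₃, h3i⟩
  have h27 : ¬ 27 ∣ (freyCurve a b).conductorNorm ℤ := fun h27 ↦ h9 (dvd_trans ⟨3, rfl⟩ h27)
  obtain ⟨ρ, hρ⟩ := (freyCurve a b).exists_isTorsionGaloisRep 5
  have hirr : FramedRep.IsIrreducible ρ := h4a a b hab h0 ρ hρ
  have h5 : ρ.IsAbsIrreducibleOverSqrt 5 := h4b (freyCurve a b) h25 ρ hρ hirr
  -- the `3`–`5` switch (Wiles' printed form, from the curve `E` itself)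
  obtain ⟨W', hW', hρ', ρ₃', hρ₃', h3i'⟩ := h3 (freyCurve a b) h27 hB ρ hρ h5
  haveI := hW'
  haveI : NeZero (W'.conductorNorm ℤ) := ⟨(conductorNorm_pos_holds W').ne'⟩
  -- `E'` is semistable at `3`, hence modular by the lifting theorem at `3`
  have h9' : ¬ 9 ∣ W'.conductorNorm ℤ := h6 (freyCurve a b) W' ρ hρ hρ' h9
  have hE' : BCDT.IsModular W' := h1 W' ρ₃' hρ₃' h3i' h9'
  -- so `ρ̄ = ρ̄_{E,5} = ρ̄_{E',5}` is modular, and `E` is modular by the lifting theorem at `5`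
  have hρmod : ρ.IsModular := hE'.isModular_of_isTorsionGaloisRep'' hρ'
  exact h2 (freyCurve a b) h25 ρ hρ h5 hρmod

/-- **The composition: the stubs imply the crux `FreyModularity`, concluded BY NAME.**  By the landed
`freyModularity_iff_forall_isModular_freyCurve` (the crux is "every Frey curve is `BCDT.IsModular`")
and `isModular_freyCurve_of_stubs` fed with the registered stubs `stub_liftThree`, `stub_liftFive`,
`stub_switch` (each VERBATIM or a RESTRICTION of an existing unproved named fact of the tree:
`CDT_theorem_7_2_1` restricted to `9 ∤ N`, `CDT_theorem_7_2_2` restricted to `25 ∤ N`,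
`CDT_three_five_switch` verbatim), the
Frey rigidity `isIrreducible_freyCurve_five` (from the four registered stubs S5–S8 of reshape 3, whose
leaves are Diamond–Kramer's `2`-adic table, the tree's Swan computations, Serre's Prop. 21 and
Kubert's `X₁(2,10)` theorem — all proved in the tree) and the LANDED stubs
`Summit.ABC.ABC.Theorems.stub_absIrrSqrtFive` (p102499) and `Summit.ABC.ABC.Theorems.stub_nineTransfer`
(p110220). [cite: ConradDiamondTaylor1999, Thm. 7.1.2 (proof, p. 556)] -/
theorem FreyModularity_of : Summit.ABC.ABC.Theses.DefiniteXi.FreyModularity :=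
  Summit.ABC.ABC.Theorems.freyModularity_iff_forall_isModular_freyCurve.mpr
    fun _ _ hab h0 _ ↦ isModular_freyCurve_of_stubs
      (liftThree_of_stubs stub_modThree stub_liftThree stub_threeImpTwo)
      (liftFive_of_stubs stub_liftFive stub_threeImpTwo) stub_switch
      isIrreducible_freyCurve_five
      Summit.ABC.ABC.Theorems.stub_absIrrSqrtFive Summit.ABC.ABC.Theorems.stub_nineTransfer hab h0

end Summit.ABC.ABC.Cruxes.FreyModularity.Sketch

end
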